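import Literature.Barriers.ValiantsHypothesis.BIJL18MatrixCompletion
import Literature.Computability.AlgebraicComplexity.BILPS19MinrankVarieties
import HarnessLib

/-!
# Barrier catalogue `ValiantsHypothesis`: membership testing in minrank varieties is NP-hard, hence
# not all their equations have small circuits unless `coNP ⊆ ∃BPP` (Bläser–Ikenmeyer–Lysikov–
# Pandey–Schreyer, §8) — typed statements

Source: M. Bläser, C. Ikenmeyer, V. Lysikov, A. Pandey, F.-O. Schreyer, *Variety membership
testing, algebraic natural proofs, and geometric complexity theory*, arXiv:1911.02534, bib key
`BlaserIkenmeyerLysikovPandeySchreyer2019` (refereed: SODA 2021, doi:10.1137/1.9781611976465.152),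
§8, FLAT arXiv numbering of the held text (`lit read paper:arxiv-1911.02534`, chunks p0032–p0035):
Problems 2–4 (p0022, p0032), Thm 33 (`HQuad` is NP-hard), Thm 34 (`HMinRank1 ≡_p HQuad`), Cor 35
(`HMinRank1` is NP-hard), Thm 36 (`HMinRank` is NP-hard for `n × (2n+1) × (2n+1)` tensors and
`r = n+1`, characteristic `0`), Cor 37 (orbit closure containment is NP-hard), Def 38 (polynomially
definable families of varieties), Thm 40 (the general barrier) and Cor 42 (no `poly(n)`-natural
proofs for minrank unless `coNP ⊆ ∃BPP`). The geometric §5–§7 statements (minrank, `𝓜_r`,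
`T_{k,n,r}`, Thms 14–27) are the sibling file
`Literature/Computability/AlgebraicComplexity/BILPS19MinrankVarieties.lean`, whose `minrank`,
`minrankSet`, `trilinearPt`, `orbitClosure3` this file uses; the Boolean vocabulary (encodings,
`IsNPHard`, `PolyTimeKarpReducible`, `coNP`, `polyExists BPP`, constant-free circuits) and the
rendering conventions are those of the tree's BIJL18 file `BIJL18MatrixCompletion.lean`
(Bläser–Ikenmeyer–Jindal–Lysikov 2018, which §8.3 generalises). Honest framing (val-lit): cite-tagged
`def … : Prop` named facts (D-0014); conditional barrier ABOUT THE MINRANK VARIETIES, not about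
`VP`; nothing here bears on `VP ≠ VNP`.

Conventions made explicit (read by referees). (1) Instances are Boolean-encoded as in BIJL18:
`HMinRank` instances `(n, k, entries ∈ ℤ^{k n²} row-major, r)` via the tree's `tensorInstEncoding`,
`HQuad` instances `(n, list of t coefficient matrices ∈ ℤ^{n×n})`, orbit-closure instances
`(n, t, t')` with `t, t' ∈ ℤ^{n×n×n}`; entries are read in the field `F` through `ℤ → F`. The printed
problems are parametrised by a coefficient domain `S`/an effective subfield `K`; the printed
reductions produce `{−1,0,1}`-coefficient quadratic forms (Thm 33) and prime-field (hence, after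
scaling slices, integer) tensor entries (Thms 34, 36), so the integer-entry sub-problems typed here
carry the printed hardness. `HQuad`'s "common zero" is a NONTRIVIAL common zero (proof of Thm 33:
"a nontrivial solution"). (2) Thm 34's "polynomial-time equivalent" is typed as Karp reductions
both ways (the printed reductions are many-one). (3) Def 39 (uniformly generated families: a Turing
machine printing circuits for a dense parametrisation) and hence the general Thm 40 are NOT typed —
the tree has no "machine outputs an arithmetic circuit" vocabulary; Thm 40 is quoted below and its
minrank instance Cor 42 is typed, exactly in the shape of the tree's `BIJL2018_thm4`: natural proofs
are explicit CONSTANT-FREE fan-in-two circuits of size `≤ n^c + c` (weaker than the printed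
`poly(n)`-size circuits with effective-field constants, hence the typed non-existence claim is
implied by the printed one), "for infinitely many `n`" = `∀ n₀, ∃ n ≥ n₀`, the "fact minrank(t) > r"
is made explicit (`t ∉ 𝓜_r`), the effective subfield is `S = ℚ` (entries of `t` rational), and the
field has characteristic `0` (PIT over `ℚ` in `BPP`, §8.2). (4) Cor 37 is typed over an algebraically
closed field of characteristic `0` (it combines Thm 36 with the orbit-closure description Cor 20).

Thm 40 (quoted, not typed): "Let `F` be a field and `K` be an effective subfield. Let `V = (V_n)` be a
p-family of varieties such that `V` is polynomially definable over `K` and uniformly generated and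
the `V`-membership problem is NP-hard. Then `coNP ⊆ ∃BPP`." (p0034:L80).
-/

noncomputable section

namespace Literature.Barriers.ValiantsHypothesis

open Literature.Computability.AlgebraicComplexity Literature.Computability.Complexity MvPolynomial
open _root_.Computability

universe u

/-! ### Problems 2–4 as Boolean languages (integer-entry instances read in `F`) -/

section Problems

variable (F : Type u) [Field F]

/-- The `k` slices `A_1, …, A_k ∈ F^{n×n}` of the tensor encoded by `(n, k, l)` (slice `a`, entry
`(i, j)` at position `a·n² + i·n + j`; missing entries `0`), i.e. the tensor
`T = ∑ e_a ⊗ A_a : Fin k → Fin n → Fin n → F`. [cite: BlaserIkenmeyerLysikovPandeySchreyer2019, Problem 2 (input)] -/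
def hmrTensorOfList (n k : ℕ) (l : List ℤ) : Fin k → Fin n → Fin n → F :=
  fun a i j => ((l.getD (a.1 * n ^ 2 + i.1 * n + j.1) 0 : ℤ) : F)

/-- The instance list has the right length `k n²` (`x = (n, k, l, r)`).
[cite: BlaserIkenmeyerLysikovPandeySchreyer2019, Problem 2 (input)] -/
def HMRWellFormed (x : ℕ × ℕ × List ℤ × ℕ) : Prop :=
  x.2.2.1.length = x.2.1 * x.1 ^ 2

/-- **Problem 2, `HMinRank_{S,F}`** ("Given a tensor `T ∈ F^{k×m×n}` with all components in `S` and a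
number `r`, decide if the minrank of `T` is at most `r`", p0022:L30), for square slices and
`S = ℤ` (read in `F`), as a Boolean language; membership = `T ∈ 𝓜_r`.
[cite: BlaserIkenmeyerLysikovPandeySchreyer2019, Problem 2] -/
def hmrLanguage : Language Bool :=
  tensorInstEncoding.toLanguage {x | HMRWellFormed x ∧
    hmrTensorOfList F x.1 x.2.1 x.2.2.1 ∈
      (minrankSet F x.2.2.2 : Set (Fin x.2.1 → Fin x.1 → Fin x.1 → F))}

/-- **Problem 3, `HMinRank1_{S,F}`** ("decide if the minrank of `T` is at most `1`", p0022:L36), same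
encoding with the bound field required to be `1`. [cite: BlaserIkenmeyerLysikovPandeySchreyer2019, Problem 3] -/
def hmr1Language : Language Bool :=
  tensorInstEncoding.toLanguage {x | HMRWellFormed x ∧ x.2.2.2 = 1 ∧
    hmrTensorOfList F x.1 x.2.1 x.2.2.1 ∈
      (minrankSet F 1 : Set (Fin x.2.1 → Fin x.1 → Fin x.1 → F))}

/-- Thm 36's shape restriction: `n × (2n+1) × (2n+1)` tensors (`n` slices of size `2n+1`) and
`r = n + 1`. [cite: BlaserIkenmeyerLysikovPandeySchreyer2019, Thm. 36] -/
def hmrLanguageShape36 : Language Bool :=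
  tensorInstEncoding.toLanguage {x | HMRWellFormed x ∧ x.1 = 2 * x.2.1 + 1 ∧ x.2.2.2 = x.2.1 + 1 ∧
    hmrTensorOfList F x.1 x.2.1 x.2.2.1 ∈
      (minrankSet F x.2.2.2 : Set (Fin x.2.1 → Fin x.1 → Fin x.1 → F))}

/-- Boolean encoding of `HQuad` instances `(n, forms)`: a list of quadratic forms in `n` variables,
each given by its `n × n` integer coefficient matrix flattened row-major ("represented by lists of
coefficients", p0032:L36). [cite: BlaserIkenmeyerLysikovPandeySchreyer2019, Problem 4 (input)] -/
def hquadInstEncoding : Encoding (ℕ × List (List ℤ)) Bool :=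
  encodingNatBool.pairBool encodingIntBool.listBool.listBool

/-- The quadratic form `q(x) = ∑_{i,j} a_{ij} x_i x_j` on `F^n` encoded by the coefficient list `l`
(`a_{ij}` at position `i·n + j`), evaluated at `x`. [cite: BlaserIkenmeyerLysikovPandeySchreyer2019, Problem 4] -/
def quadFormOfList (n : ℕ) (l : List ℤ) (x : Fin n → F) : F :=
  ∑ i : Fin n, ∑ j : Fin n, ((l.getD (i.1 * n + j.1) 0 : ℤ) : F) * x i * x j

/-- **Problem 4, `HQuad_{S,F}`** ("Given a set of quadratic forms with coefficients from `S`,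
represented by lists of coefficients, determine if it has a common zero over `F`", p0032:L36 — a
NONTRIVIAL common zero, proof of Thm 33), with `S = {−1, 0, 1}` (Thm 33), as a Boolean language.
[cite: BlaserIkenmeyerLysikovPandeySchreyer2019, Problem 4] -/
def hquadLanguage : Language Bool :=
  hquadInstEncoding.toLanguage {x | (∀ l ∈ x.2, l.length = x.1 ^ 2 ∧ ∀ a ∈ l, a = 0 ∨ a = 1 ∨ a = -1) ∧
    ∃ v : Fin x.1 → F, v ≠ 0 ∧ ∀ l ∈ x.2, quadFormOfList F x.1 l v = 0}

/-- `HQuad_{ℤ,F}`: the same problem with arbitrary integer coefficients (the coefficient domain of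
Thm 34's equivalence, an effective prime subfield read through `ℤ`).
[cite: BlaserIkenmeyerLysikovPandeySchreyer2019, Problem 4] -/
def hquadZLanguage : Language Bool :=
  hquadInstEncoding.toLanguage {x | (∀ l ∈ x.2, l.length = x.1 ^ 2) ∧
    ∃ v : Fin x.1 → F, v ≠ 0 ∧ ∀ l ∈ x.2, quadFormOfList F x.1 l v = 0}

/-- Boolean encoding of orbit-closure-containment instances `(n, t, t')`, `t, t' ∈ ℤ^{n×n×n}`
flattened. [cite: BlaserIkenmeyerLysikovPandeySchreyer2019, Cor. 37 (input)] -/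
def occInstEncoding : Encoding (ℕ × List ℤ × List ℤ) Bool :=
  encodingNatBool.pairBool (encodingIntBool.listBool.pairBool encodingIntBool.listBool)

/-- The cubic tensor `t ∈ F^{n×n×n}` encoded by `l` (entry `(a,b,c)` at `a·n² + b·n + c`).
[cite: BlaserIkenmeyerLysikovPandeySchreyer2019, Cor. 37 (input)] -/
def cubeOfList (n : ℕ) (l : List ℤ) : Fin n → Fin n → Fin n → F :=
  fun a b c => ((l.getD (a.1 * n ^ 2 + b.1 * n + c.1) 0 : ℤ) : F)

/-- **The orbit closure containment problem** ("Given two tensors `t` and `t'`, deciding whether the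
orbit closure of `t` is contained in the orbit closure of `t'` (under the usual `GL_n × GL_n × GL_n`
action)", Cor 37, p0034:L38), integer-entry instances read in `F`, as a Boolean language.
[cite: BlaserIkenmeyerLysikovPandeySchreyer2019, Cor. 37] -/
def occLanguage : Language Bool :=
  occInstEncoding.toLanguage {x | x.2.1.length = x.1 ^ 3 ∧ x.2.2.length = x.1 ^ 3 ∧
    orbitClosure3 (cubeOfList F x.1 x.2.1) ⊆ orbitClosure3 (cubeOfList F x.1 x.2.2)}

end Problems

/-! ### Thm 33, Thm 34, Cor 35, Thm 36, Cor 37: NP-hardness -/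

section Hardness

variable (F : Type u) [Field F]

-- FACT (NP-hardness; reduction from graph 3-colourability)
/-- **BILPS Thm 33.** "`HQuad_{{0,1,−1}, F}` is NP-hard for any field `F`." (p0033:L20; reduction from
graph `3`-colorability with the vertex equations `x_v y_v = 0`, `x_v² − x_v z = 0`, `y_v² − y_v z = 0`
and one edge equation per edge). [cite: BlaserIkenmeyerLysikovPandeySchreyer2019, Thm. 33] -/
def BILPS2019_thm33 : Prop :=
  IsNPHard (hquadLanguage F)

-- FACT (two Karp reductions)
/-- **BILPS Thm 34.** "Let `F` be a field and `K` be an effective subfield of `F`. Then `HMinRank1_{K,F}`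
is polynomial-time equivalent to `HQuad_{K,F}`." (p0033:L77; `rk(Tx) ≤ 1` is the vanishing of the
`2 × 2` minors of `Tx`; conversely a kernel basis of the coefficient map `Sym² Kⁿ → Kᵗ`). Typed for
the integer-entry problems (module docstring (1)–(2)). [cite: BlaserIkenmeyerLysikovPandeySchreyer2019, Thm. 34] -/
def BILPS2019_thm34 : Prop :=
  PolyTimeKarpReducible (hmr1Language F) (hquadZLanguage F) ∧
    PolyTimeKarpReducible (hquadZLanguage F) (hmr1Language F)

-- FACT
/-- **BILPS Cor 35.** "Let `F` be a field and `K` be an effective subfield of `F`. Then `HMinRank1_{K,F}`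
is NP-hard." (p0033:L95) — "even deciding whether the minrank is `≤ 1` is already NP-hard" (§2.5).
[cite: BlaserIkenmeyerLysikovPandeySchreyer2019, Cor. 35] -/
def BILPS2019_cor35 : Prop :=
  IsNPHard (hmr1Language F)

-- FACT (characteristic 0; reduction from a Partition variant via [Vardy97]/[Courtois01])
/-- **BILPS Thm 36.** "Let `F` be a field of characteristic `0` and `K` be an effective subfield of
`F`. Then `HMinRank_{K,F}` is NP-hard for `n × (2n+1) × (2n+1)` tensors and `r = n + 1`."
(p0034:L1). [cite: BlaserIkenmeyerLysikovPandeySchreyer2019, Thm. 36] -/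
def BILPS2019_thm36 [CharZero F] : Prop :=
  IsNPHard (hmrLanguageShape36 F)

-- FACT
/-- **BILPS Cor 37 (orbit closure containment is NP-hard).** "Given two tensors `t` and `t'`, deciding
whether the orbit closure of `t` is contained in the orbit closure of `t'` (under the usual
`GL_n × GL_n × GL_n` action) is NP-hard." (p0034:L38; from Thm 36 and the orbit-closure description
of the minrank varieties, Cor 20). Typed over an algebraically closed field of characteristic `0`
(module docstring (4)). [cite: BlaserIkenmeyerLysikovPandeySchreyer2019, Cor. 37] -/
def BILPS2019_cor37 [IsAlgClosed F] [CharZero F] : Prop :=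
  IsNPHard (occLanguage F)

end Hardness

/-! ### §8.3 Def 38, and the minrank barrier Cor 42 (instance of Thm 40) -/

section NaturalProofs

variable (F : Type u) [Field F]

/-- **BILPS Def 38 (polynomially definable families of varieties).** "A family of varieties `(V_n)`
[`V_n ⊆ F^{p(n)}`, a p-family] is polynomially definable, if for each `n`, there are polynomials
`f_1, …, f_m` such that `V_n` is the common zero set of these polynomials and `L(f_i)` is polynomially
bounded in `n` for all `1 ≤ i ≤ m`. Here `L(f_i)` denotes the algebraic circuit complexity of `f_i`
… Note that we do not require that `m` is polynomially bounded in `n`." (p0034:L59–66). `L` = the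
tree's fan-in-two circuit size `complexity` (constants from `F`); "polynomially bounded" =
`≤ n^c + c`. [cite: BlaserIkenmeyerLysikovPandeySchreyer2019, Def. 38] -/
def IsPolyDefinable (p : ℕ → ℕ) (V : ∀ n, Set (Fin (p n) → F)) : Prop :=
  ∃ c : ℕ, ∀ n, ∃ E : Set (MvPolynomial (Fin (p n)) F),
    (∀ x, x ∈ V n ↔ ∀ f ∈ E, eval x f = 0) ∧ ∀ f ∈ E, complexity f ≤ n ^ c + c

-- PROVED (definition)
/-- **An algebraic natural proof of constant-free size `≤ s` for "minrank(T) > r"** (Def 1 with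
`𝒟` = size-`≤ s` constant-free fan-in-two circuits, `𝒞 = 𝓜_r`, `f₀ = T`, as in the tree's
`IsBorderCRProof`): `p(T) ≠ 0`, `p` vanishes on `𝓜_r ⊆ F^{m×n×n}`, and `p` has an explicit
constant-free circuit of size `≤ s`. [cite: BlaserIkenmeyerLysikovPandeySchreyer2019, Def. 1 and Cor. 42] -/
def IsMinrankProof {m n : ℕ} (T : Fin m → Fin n → Fin n → F) (r s : ℕ)
    (p : MvPolynomial (Fin m × Fin n × Fin n) F) : Prop :=
  eval (trilinearPt T) p ≠ 0 ∧
    (∀ T' : Fin m → Fin n → Fin n → F,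
      T' ∈ (minrankSet F r : Set (Fin m → Fin n → Fin n → F)) → eval (trilinearPt T') p = 0) ∧
    ∃ P : ArithCircuit F (Fin m × Fin n × Fin n),
      P.IsFanInTwo ∧ P.HasSignConstants ∧ P.Computes p ∧ P.size ≤ s

-- FACT (R1: class hypothesis coNP ⊄ ∃BPP) — a CONDITIONAL barrier about the minrank varieties
/-- **BILPS Cor 42 (conditional barrier for minrank; the minrank instance of Thm 40).** "Let `S` be an
effective subfield of `F`. For infinitely many `n`, there is an `m`, a tensor `t ∈ S^{m×n×n}` and a
value `r` such that there is no algebraic `poly(n)`-natural proof for the fact that the minrank of `t`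
is greater than `r` unless `coNP ⊆ ∃BPP`." (p0035:L37; proof: otherwise the minrank varieties are
p-definable, they are uniformly generated as orbit closures (Lemma 41, Thm 19), and Thm 40 applies).
Typed (module docstring (3)): if `¬ coNP ⊆ ∃·BPP` then for every size exponent `c`, for infinitely
many `n`, some tensor `t` with rational entries and some `r` with `t ∉ 𝓜_r` admit no natural proof of
constant-free size `≤ n^c + c`; `F` of characteristic `0` (`S = ℚ`). technique_class: algebraically
natural proofs (`VP`-size constant-free distinguishers, FSV/GKSS Def 1) against the minrank varieties
`𝓜_r ⊆ F^{m×n×n}` [cite: BlaserIkenmeyerLysikovPandeySchreyer2019, Def. 1]. blocks: complete sets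
of `poly(n)`-size equations for all minrank varieties ("in a full set of equations … not all of them
will have algebraic circuits of polynomial size", §2.5) [cite: BlaserIkenmeyerLysikovPandeySchreyer2019, §2.5].
because: a guessed small equation is verified by PIT against a dense parametrisation of the orbit
closure and then evaluated at the point, putting the coNP-hard non-membership problem (Cor 35 /
Thm 36) in `∃BPP` [cite: BlaserIkenmeyerLysikovPandeySchreyer2019, Thm. 40 (proof)]. evasions_known:
equations given succinctly — "succinctly represented exponential size determinants, succinctly
represented exponential sums, or succinct representation-theoretic objects" (§2.6), whose vanishing
on the variety is proved without evaluating a circuit; the symmetry-characterisation of the point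
(§2.6, Thm 22) [cite: BlaserIkenmeyerLysikovPandeySchreyer2019, §2.6]. scope_caveats: conditional
on `coNP ⊄ ∃BPP`; about the minrank (and, by the printed Remark, slice-rank) varieties, whose
membership problem is NP-hard — NOT about `VP`, the orbit closure of the determinant or border rank,
whose membership complexity is open (§1.1, §2.6 last item); constant-free distinguishers as typed.
status: established (conditional theorem). [cite: BlaserIkenmeyerLysikovPandeySchreyer2019, Cor. 42] -/
def BILPS2019_cor42 [CharZero F] : Prop :=
  ¬ (coNP ⊆ polyExists BPP) →
    ∀ c n₀ : ℕ, ∃ n : ℕ, n₀ ≤ n ∧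
      ∃ (m : ℕ) (T : Fin m → Fin n → Fin n → F) (r : ℕ),
        (∀ v, ∃ q : ℚ, trilinearPt T v = (q : F)) ∧
        T ∉ (minrankSet F r : Set (Fin m → Fin n → Fin n → F)) ∧
        ∀ p, ¬ IsMinrankProof F T r (n ^ c + c) p

end NaturalProofs

end Literature.Barriers.ValiantsHypothesis
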